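import Literature.Computability.AlgebraicComplexity.MS21ANFThm35LargeChar
import Literature.Computability.AlgebraicComplexity.MS21ANFHasseQuarterStructure
import HarnessLib

/-!
# Medini–Shpilka 2021, Thm 35 (`thm:pitRoanf`), every characteristic: the endgame binder

Seat t17 g5's `MS2021.support_affSubst_anf_subset_of_extraction` (`MS21ANFHasseQuarterStructure`)
derives the structure lemma `hstruct` (all `Δ`) from an extraction hypothesis `hS3` quantified over
EVERY `Δ`, including `Δ = 0` (level `ANF₁`).  At `Δ = 0` the extracted clause (AB) is FALSE in
characteristic `2`: over `𝔽₂`, `M` with rows `y₀, y₁ + y₂, y₂, y₃ + y₀` is invertible,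
`ANF₁(My) = y₀y₁ + y₂y₃ + 2y₀y₂ = ANF₁` passes every second-order Hasse test, yet column `0` meets row
block `0` and column `2` meets row block `1` with `∂₀∂₂ ANF₁ = 0` (the top pair of `ANF₁` is a
SIBLING pair, so only the symmetrised condition (γ) of the blueprint holds, not (α)/(AB); seat
x5 g3, `compute/b36s3.py`).  Hence the induction must start from the bases `Δ = 0` AND `Δ = 1` and use
the extraction only for `Δ ≥ 1` (levels `≥ 2`, where the top `×`-pairs are non-sibling — exactly the
hypothesis `1 ≤ Δ` of seat t18 g5's `anf_succ_hasseD_two_extract` / `anf_succ_pderiv_pderiv_extract`,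
`MS21ANFHasseBlockExtraction`).

This file (theorems only; no definitions, no new named facts, D-0026) records that corrected
endgame: `MS2021.hstruct_of_base_one_of_extraction_pos` — the structure lemma for all `Δ` from
(a) the base `Δ = 1` (`hbase1`: `M ∈ GL_4`, the two Hasse hypotheses ⇒ `mon(ANF₁(My)) ⊆ mon(ANF₁)`)
and (b) the extraction `hS3` for `1 ≤ Δ` (t17's binder verbatim plus `1 ≤ Δ`), by the recursion
`0 ↦ support_affSubst_anf_zero_subset`, `1 ↦ hbase1`, `Δ+2 ↦ support_affSubst_anf_succ_subset (Δ+1)`;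
and `MS2021_thm_35_of_base_one_of_extraction_pos : hbase1 → hS3 → MS2021_thm_35`
(via `MS2021_thm_35_of_structureLemma`, `MS21ANFThm35LargeChar`).

HONEST FRAMING: `hbase1` and `hS3` (seat t18 g5, B36 stages S3/S5) are NOT proved here;
`MS2021_thm_35` is NOT discharged here.  `VP ≠ VNP` is NOT proved and nothing here bears on it.

## References
* [MediniShpilka2021] D. Medini, A. Shpilka, CCC 2021 (LIPIcs 200:19) = arXiv:2102.05632: Thm 35
  (CCC p.19:13; arXiv p0008:L29–30), proof §5.2 (p0030:L28–p0031:L24), Lemma 5.13 (p0029:L3–L13).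
-/

noncomputable section

open MvPolynomial
open scoped Matrix

namespace Literature.Computability.AlgebraicComplexity

namespace MS2021

section Endgame

variable {K : Type} [Field K]

/-- **The structure lemma for every `Δ` from the base `Δ = 1` and the extraction for `Δ ≥ 1`.**
[cite: MediniShpilka2021, Lemma 5.13 (arXiv p0029:L3–L13), characteristic-free form (registry B36)] -/
theorem hstruct_of_base_one_of_extraction_pos
    (hbase1 : ∀ N : Matrix (Fin (4 ^ 1)) (Fin (4 ^ 1)) K, IsUnit N.det →
      (∀ j, hasseD 2 (fun a => N a j) (anf K 1) = 0) →
      (∀ j j', pderiv j (pderiv j' (anf K 1)) = 0 →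
        (∑ a, ∑ a', C (N a j * N a' j') * pderiv a (pderiv a' (anf K 1))) = 0) →
      (affSubst le_rfl N 0 (anf K 1)).support ⊆ (anf K 1).support)
    (hS3 : ∀ (Δ : ℕ), 1 ≤ Δ → ∀ (M : Matrix (Fin (4 ^ (Δ + 1))) (Fin (4 ^ (Δ + 1))) K),
      IsUnit M.det →
      (∀ k, hasseD 2 (fun a => M a k) (anf K (Δ + 1)) = 0) →
      (∀ k l, pderiv k (pderiv l (anf K (Δ + 1))) = 0 →
        (∑ a, ∑ a', C (M a k * M a' l) * pderiv a (pderiv a' (anf K (Δ + 1)))) = 0) →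
      (∀ (b : Fin 4) (k l : Fin (4 ^ (Δ + 1))), pderiv k (pderiv l (anf K (Δ + 1))) = 0 →
          (∃ j, M (anfBlock Δ b j) k ≠ 0) → (∃ j, M (anfBlock Δ (1 - b) j) l ≠ 0) → False) ∧
        (∀ (b : Fin 4) (k : Fin (4 ^ (Δ + 1))),
          hasseD 2 (fun a => M (anfBlock Δ b a) k) (anf K Δ) = 0) ∧
        (∀ (b : Fin 4) (k l : Fin (4 ^ (Δ + 1))), pderiv k (pderiv l (anf K (Δ + 1))) = 0 →
          (∑ a, ∑ a', C (M (anfBlock Δ b a) k * M (anfBlock Δ b a') l) *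
            pderiv a (pderiv a' (anf K Δ))) = 0)) :
    ∀ (Δ : ℕ) (N : Matrix (Fin (4 ^ Δ)) (Fin (4 ^ Δ)) K), IsUnit N.det →
      (∀ j, hasseD 2 (fun a => N a j) (anf K Δ) = 0) →
      (∀ j j', pderiv j (pderiv j' (anf K Δ)) = 0 →
        (∑ a, ∑ a', C (N a j * N a' j') * pderiv a (pderiv a' (anf K Δ))) = 0) →
      (affSubst le_rfl N 0 (anf K Δ)).support ⊆ (anf K Δ).support
  | 0, N, _, _, _ => support_affSubst_anf_zero_subset N
  | 1, N, hN, h2, h11 => hbase1 N hN h2 h11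
  | Δ + 2, N, hN, h2, h11 => by
    obtain ⟨hAB, hH, hP⟩ := hS3 (Δ + 1) (Nat.succ_pos Δ) N hN h2 h11
    exact support_affSubst_anf_succ_subset (Δ + 1)
      (fun N' hN' h2' h11' =>
        hstruct_of_base_one_of_extraction_pos hbase1 hS3 (Δ + 1) N' hN' h2' h11')
      N hN hAB hH hP

end Endgame

end MS2021

open MS2021

/-- **MS Thm 35 (all fields, as typed) from the base `Δ = 1` of the structure lemma and the
extraction for `Δ ≥ 1`** (the corrected endgame of the B36 repair).
[cite: MediniShpilka2021, Thm 35 (CCC p.19:13; arXiv p0008:L29-30); proof §5.2 (arXiv p0030:L28–p0031:L24)] -/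
theorem MS2021_thm_35_of_base_one_of_extraction_pos
    (hbase1 : ∀ (K : Type) [Field K] (N : Matrix (Fin (4 ^ 1)) (Fin (4 ^ 1)) K), IsUnit N.det →
      (∀ j, hasseD 2 (fun a => N a j) (anf K 1) = 0) →
      (∀ j j', pderiv j (pderiv j' (anf K 1)) = 0 →
        (∑ a, ∑ a', C (N a j * N a' j') * pderiv a (pderiv a' (anf K 1))) = 0) →
      (affSubst le_rfl N 0 (anf K 1)).support ⊆ (anf K 1).support)
    (hS3 : ∀ (K : Type) [Field K] (Δ : ℕ), 1 ≤ Δ →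
      ∀ (M : Matrix (Fin (4 ^ (Δ + 1))) (Fin (4 ^ (Δ + 1))) K), IsUnit M.det →
      (∀ k, hasseD 2 (fun a => M a k) (anf K (Δ + 1)) = 0) →
      (∀ k l, pderiv k (pderiv l (anf K (Δ + 1))) = 0 →
        (∑ a, ∑ a', C (M a k * M a' l) * pderiv a (pderiv a' (anf K (Δ + 1)))) = 0) →
      (∀ (b : Fin 4) (k l : Fin (4 ^ (Δ + 1))), pderiv k (pderiv l (anf K (Δ + 1))) = 0 →
          (∃ j, M (anfBlock Δ b j) k ≠ 0) → (∃ j, M (anfBlock Δ (1 - b) j) l ≠ 0) → False) ∧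
        (∀ (b : Fin 4) (k : Fin (4 ^ (Δ + 1))),
          hasseD 2 (fun a => M (anfBlock Δ b a) k) (anf K Δ) = 0) ∧
        (∀ (b : Fin 4) (k l : Fin (4 ^ (Δ + 1))), pderiv k (pderiv l (anf K (Δ + 1))) = 0 →
          (∑ a, ∑ a', C (M (anfBlock Δ b a) k * M (anfBlock Δ b a') l) *
            pderiv a (pderiv a' (anf K Δ))) = 0)) :
    MS2021_thm_35 :=
  MS2021_thm_35_of_structureLemma fun K _ Δ N hN h2 h11 =>
    hstruct_of_base_one_of_extraction_pos (hbase1 K) (hS3 K) Δ N hN h2 h11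

end Literature.Computability.AlgebraicComplexity

end
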